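import Mathlib
import HarnessLib

/-!
# Line `Sketch` (v8) for crux `MagicFormulaT`, stub T `stub_taylorLimit` — coefficientwise convergence
# of a normal family of entire functions is pointwise convergence

Crux `Summit.CriticalPhenomena.CardyFormulaZ2.Theses.CardyMagicRigidity.MagicFormulaT`
(stmt-CriticalPhenomena-4836), line `Sketch`, registered skeleton v8, stub `stub_taylorLimit`.

Pure complex analysis (Mathlib only).  If `F δ` is entire for all small `δ > 0`, the family is bounded on
every closed ball `‖s‖ ≤ ρ` eventually in `δ`, and every Taylor coefficient `(F δ)^{(k)}(0)` converges to
`G^{(k)}(0)` for an entire `G`, then `F δ t → G t` for every `t ∈ ℂ`.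

Proof.  Fix `t` and the Cauchy radius `r = ‖t‖ + 1`.  The Cauchy estimate
`Complex.norm_iteratedDeriv_le_of_forall_mem_sphere_norm_le` on the sphere of radius `r` bounds the `n`-th
Taylor term `(n!)⁻¹ tⁿ (F δ)^{(n)}(0)` by `M (‖t‖/r)ⁿ`, a summable geometric majorant independent of `δ`
(eventually in `δ`); each term converges by hypothesis; Tannery's theorem
(`tendsto_tsum_of_dominated_convergence`) gives convergence of the Taylor sums, which are `F δ t`
(eventually) and `G t` by `Complex.taylorSeries_eq_of_entire`.

No named fact is used; no definition is introduced.
-/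

noncomputable section

namespace Summit.CriticalPhenomena.CardyFormulaZ2.Cruxes.MagicFormulaT.LineSketch

open MeasureTheory Filter Set
open scoped Real Topology BigOperators ENNReal

/-- **Cauchy bound on a Taylor term.**  If `f` is entire and `‖f z‖ ≤ C` on the closed ball `‖z‖ ≤ R`,
`R > 0`, then the `n`-th Taylor term of `f` at `0`, evaluated at `z`, has norm at most `C (‖z‖/R)ⁿ`. -/
theorem stubTaylorLimit_norm_taylorTerm_le {f : ℂ → ℂ} (hf : Differentiable ℂ f) {R C : ℝ}
    (hR : 0 < R) (hC : ∀ z : ℂ, ‖z‖ ≤ R → ‖f z‖ ≤ C) (z : ℂ) (n : ℕ) :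
    ‖(n.factorial : ℂ)⁻¹ • (z - 0) ^ n • iteratedDeriv n f 0‖ ≤ C * (‖z‖ / R) ^ n := by
  have h1 : ‖iteratedDeriv n f 0‖ ≤ n.factorial * C / R ^ n :=
    Complex.norm_iteratedDeriv_le_of_forall_mem_sphere_norm_le n hR hf.diffContOnCl
      (fun w hw ↦ hC w (mem_sphere_zero_iff_norm.1 hw).le)
  have hn : (0 : ℝ) < n.factorial := by exact_mod_cast Nat.factorial_pos n
  rw [norm_smul, norm_smul, norm_inv, norm_pow, sub_zero, Complex.norm_natCast, div_pow]
  calc (n.factorial : ℝ)⁻¹ * (‖z‖ ^ n * ‖iteratedDeriv n f 0‖)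
      ≤ (n.factorial : ℝ)⁻¹ * (‖z‖ ^ n * (n.factorial * C / R ^ n)) := by gcongr
    _ = C * (‖z‖ ^ n / R ^ n) := by field_simp

/-- **Stub T (`stub_taylorLimit`) · coefficientwise convergence of a normal family of entire functions is
convergence.**  If `F_δ` is entire for all small `δ`, uniformly bounded on each closed ball eventually in `δ`, and
every Taylor coefficient at `0` converges to that of an entire `G`, then `F_δ(t) → G(t)` for every `t ∈ ℂ`.
Pure Mathlib: Cauchy estimates `Complex.norm_iteratedDeriv_le_of_forall_mem_sphere_norm_le` on the sphere of radius
`‖t‖+1` bound the terms of the Taylor series (`Complex.taylorSeries_eq_of_entire`) by a geometric series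
uniformly in `δ`; Tannery's theorem `tendsto_tsum_of_dominated_convergence` concludes. -/
theorem stub_taylorLimit : ∀ (F : ℝ → ℂ → ℂ) (G : ℂ → ℂ),
    (∀ᶠ δ in 𝓝[>] (0 : ℝ), Differentiable ℂ (F δ)) → Differentiable ℂ G →
    (∀ ρ : ℝ, 0 < ρ → ∃ M : ℝ, ∀ᶠ δ in 𝓝[>] (0 : ℝ), ∀ t : ℂ, ‖t‖ ≤ ρ → ‖F δ t‖ ≤ M) →
    (∀ k : ℕ, Tendsto (fun δ ↦ iteratedDeriv k (F δ) 0) (𝓝[>] (0 : ℝ)) (𝓝 (iteratedDeriv k G 0))) →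
    ∀ t : ℂ, Tendsto (fun δ ↦ F δ t) (𝓝[>] (0 : ℝ)) (𝓝 (G t)) := by
  intro F G hdiff hG hbound hcoeff t
  -- Cauchy radius `r = ‖t‖ + 1`, ratio `‖t‖ / r < 1`
  have hr_pos : 0 < ‖t‖ + 1 := by positivity
  have hq_nonneg : 0 ≤ ‖t‖ / (‖t‖ + 1) := by positivity
  have hq_lt : ‖t‖ / (‖t‖ + 1) < 1 := (div_lt_one hr_pos).2 (lt_add_one _)
  obtain ⟨M, hM⟩ := hbound (‖t‖ + 1) hr_pos
  -- termwise convergence of the Taylor series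
  have hterm : ∀ n : ℕ,
      Tendsto (fun δ ↦ (n.factorial : ℂ)⁻¹ • (t - 0) ^ n • iteratedDeriv n (F δ) 0) (𝓝[>] (0 : ℝ))
        (𝓝 ((n.factorial : ℂ)⁻¹ • (t - 0) ^ n • iteratedDeriv n G 0)) := fun n ↦
    ((hcoeff n).const_smul _).const_smul _
  -- uniform geometric domination, eventually in `δ`
  have hdom : ∀ᶠ δ in 𝓝[>] (0 : ℝ), ∀ n : ℕ,
      ‖(n.factorial : ℂ)⁻¹ • (t - 0) ^ n • iteratedDeriv n (F δ) 0‖ ≤ M * (‖t‖ / (‖t‖ + 1)) ^ n := by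
    filter_upwards [hdiff, hM] with δ hd hb n
    exact stubTaylorLimit_norm_taylorTerm_le hd hr_pos hb t n
  have hsum : Summable fun n : ℕ ↦ M * (‖t‖ / (‖t‖ + 1)) ^ n :=
    (summable_geometric_of_lt_one hq_nonneg hq_lt).mul_left M
  -- Tannery
  have key : Tendsto (fun δ ↦ ∑' n : ℕ, (n.factorial : ℂ)⁻¹ • (t - 0) ^ n • iteratedDeriv n (F δ) 0)
      (𝓝[>] (0 : ℝ)) (𝓝 (∑' n : ℕ, (n.factorial : ℂ)⁻¹ • (t - 0) ^ n • iteratedDeriv n G 0)) :=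
    tendsto_tsum_of_dominated_convergence hsum hterm hdom
  rw [Complex.taylorSeries_eq_of_entire hG 0 t] at key
  refine key.congr' ?_
  filter_upwards [hdiff] with δ hd
  exact Complex.taylorSeries_eq_of_entire hd 0 t

end Summit.CriticalPhenomena.CardyFormulaZ2.Cruxes.MagicFormulaT.LineSketch

end
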